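import Mathlib.Analysis.SpecialFunctions.Pow.Real
import HarnessLib

/-!
# Matomäki–Merikoski §7, main terms: partial summation against the smooth dyadic cutoff

Topic `Literature/Barriers/Parity`; sibling of the `SiegelZeroPrimePairs*` files.  Everything here is PROVED
(theorems only).  In §7 of Matomäki–Merikoski (IMRN 2023; arXiv:2112.11412, p. 20–21) the main terms
`Σ̃_{S,S}`, `Σ̃_{L,L}` contain `∑_{m rough} χ(m) log(y/m) w(m)/m` with the cutoff weight
`w(m) = ∑_{M = 2^i ≤ X^{1/2}} F(m/M) ∈ [0,1]`, `= 1` for `m ≤ X^{1/2}/4`, `= 0` for `m ≥ 4X^{1/2}` and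
non-increasing in between, and the source says: "Hence by partial summation and Lemmas 2.4 and 2.5 … we
obtain … `(1 + O(𝓔)) ∏_{p<z}(1 − 1/p)^{−1}`".  This file isolates the partial-summation step as a discrete
statement with no calculus: if the partial sums `A(N) = ∑_{n ≤ N} a_n` satisfy `|A(N) − V| ≤ εV` for all
integers `N` in the transition range `[L₀, L₁]` of an antitone cutoff `w` (`w = 1` up to `L₀`, `w = 0` after
`L₁`), then `|∑_n a_n w(n) − V| ≤ εV` (`MatomakiMerikoski.abs_sum_mul_cutoff_sub_le`), via the Abel identity
`∑_{n ≤ L} a_n w(n) = ∑_{N ≤ L} A(N)(w(N) − w(N+1)) + A(L) w(L+1)` (`sum_mul_eq_sum_partial_mul_sub`).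

## References

* K. Matomäki, J. Merikoski, IMRN 2023:23, 20337–20384 (arXiv:2112.11412), §7, evaluation of `Σ̃_{S,S}`
  ("by partial summation and Lemmas 2.4 and 2.5"). [cite: MatomakiMerikoski2023, §7 (main term of Σ_{S,S})]
-/

open Finset

namespace Literature.Barriers.Parity.MatomakiMerikoski

/-- **Abel summation with a cutoff weight** (discrete): for all `L`,
`∑_{1 ≤ n ≤ L} a(n) w(n) = ∑_{1 ≤ N ≤ L} A(N) (w(N) − w(N+1)) + A(L) w(L+1)`, `A(N) = ∑_{1 ≤ n ≤ N} a(n)`.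
[folklore] -/
theorem sum_mul_eq_sum_partial_mul_sub (a w : ℕ → ℝ) (L : ℕ) :
    ∑ n ∈ Icc 1 L, a n * w n =
      ∑ N ∈ Icc 1 L, (∑ n ∈ Icc 1 N, a n) * (w N - w (N + 1)) + (∑ n ∈ Icc 1 L, a n) * w (L + 1) := by
  induction L with
  | zero => simp
  | succ L ih =>
    have h01 : 1 ≤ L + 1 := by omega
    rw [Finset.sum_Icc_succ_top h01, ih]
    simp only [Finset.sum_Icc_succ_top h01]
    ring

/-- **Partial summation against an antitone cutoff.**  Let `1 ≤ L₀ ≤ L₁`, `w = 1` on `[0, L₀]`, `w = 0` beyond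
`L₁`, `w(N+1) ≤ w(N)` for `N ≥ L₀`, and suppose the partial sums satisfy `|∑_{n ≤ N} a(n) − V| ≤ ε V` for all
integers `L₀ ≤ N ≤ L₁` (any reals `ε, V`).  Then `|∑_{1 ≤ n ≤ L₁} a(n) w(n) − V| ≤ ε V`.
[cite: MatomakiMerikoski2023, §7 (main term of Σ_{S,S}, "by partial summation")] -/
theorem abs_sum_mul_cutoff_sub_le {a w : ℕ → ℝ} {V ε : ℝ} {L₀ L₁ : ℕ} (hL : 1 ≤ L₀) (hL01 : L₀ ≤ L₁)
    (hw1 : ∀ n, n ≤ L₀ → w n = 1) (hw0 : ∀ n, L₁ < n → w n = 0)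
    (hanti : ∀ n, L₀ ≤ n → w (n + 1) ≤ w n)
    (hA : ∀ N, L₀ ≤ N → N ≤ L₁ → |∑ n ∈ Icc 1 N, a n - V| ≤ ε * V) :
    |∑ n ∈ Icc 1 L₁, a n * w n - V| ≤ ε * V := by
  set A : ℕ → ℝ := fun N => ∑ n ∈ Icc 1 N, a n with hAdef
  rw [sum_mul_eq_sum_partial_mul_sub a w L₁, hw0 (L₁ + 1) (Nat.lt_succ_self _), mul_zero, add_zero]
  -- the differences `w(N) − w(N+1)` vanish below `L₀` and telescope to `1` on `[L₀, L₁]`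
  have hsplit : ∀ f : ℕ → ℝ, ∑ N ∈ Icc 1 L₁, f N * (w N - w (N + 1)) =
      ∑ N ∈ Icc L₀ L₁, f N * (w N - w (N + 1)) := by
    intro f
    have hsub : Icc L₀ L₁ ⊆ Icc 1 L₁ := by
      intro N hN; rw [mem_Icc] at hN ⊢; omega
    rw [← sum_sdiff hsub]
    have hzero : ∑ N ∈ Icc 1 L₁ \ Icc L₀ L₁, f N * (w N - w (N + 1)) = 0 := by
      refine sum_eq_zero fun N hN => ?_
      rw [mem_sdiff, mem_Icc, mem_Icc] at hN
      have hN' : N < L₀ := by omega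
      rw [hw1 N hN'.le, hw1 (N + 1) (by omega), sub_self, mul_zero]
    rw [hzero, zero_add]
  have htel : ∑ N ∈ Icc L₀ L₁, (w N - w (N + 1)) = 1 := by
    have key : ∀ L, L₀ ≤ L → ∑ N ∈ Icc L₀ L, (w N - w (N + 1)) = w L₀ - w (L + 1) := by
      intro L hLL
      induction L with
      | zero => omega
      | succ L ih =>
        rcases Nat.eq_or_lt_of_le hLL with h | h
        · rw [← h, Icc_self, sum_singleton]
        · have hL' : L₀ ≤ L := by omega
          have h1 : Icc L₀ (L + 1) = insert (L + 1) (Icc L₀ L) := by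
            ext n; simp only [mem_insert, mem_Icc]; omega
          have hnot : L + 1 ∉ Icc L₀ L := by simp
          rw [h1, sum_insert hnot, ih hL']
          ring
    rw [key L₁ hL01, hw1 L₀ le_rfl, hw0 (L₁ + 1) (Nat.lt_succ_self _), sub_zero]
  -- rewrite `V = ∑ V (w N − w (N+1))` over the transition range and compare termwise
  have hVsum : V = ∑ N ∈ Icc L₀ L₁, V * (w N - w (N + 1)) := by rw [← mul_sum, htel, mul_one]
  rw [hsplit A]
  calc |∑ N ∈ Icc L₀ L₁, A N * (w N - w (N + 1)) - V|
      = |∑ N ∈ Icc L₀ L₁, (A N - V) * (w N - w (N + 1))| := by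
        congr 1
        conv_lhs => rw [hVsum]
        rw [← sum_sub_distrib]
        refine sum_congr rfl fun N _ => by ring
    _ ≤ ∑ N ∈ Icc L₀ L₁, |(A N - V) * (w N - w (N + 1))| := abs_sum_le_sum_abs _ _
    _ ≤ ∑ N ∈ Icc L₀ L₁, ε * V * (w N - w (N + 1)) := by
        refine sum_le_sum fun N hN => ?_
        rw [mem_Icc] at hN
        have hΔ : 0 ≤ w N - w (N + 1) := sub_nonneg.mpr (hanti N hN.1)
        rw [abs_mul, abs_of_nonneg hΔ]
        exact mul_le_mul_of_nonneg_right (hA N hN.1 hN.2) hΔ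
    _ = ε * V := by rw [← mul_sum, htel, mul_one]

end Literature.Barriers.Parity.MatomakiMerikoski
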